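import Literature.Probability.Percolation.FourArmGarbanProofs
import Literature.Probability.Percolation.OrthogonalRevealmentBound
import HarnessLib

/-!
# Garban's multi-scale four-arm bound: the assembly from a "two-layers majority" scheme

Topic `Literature/Probability/Percolation`; support file for the named fact
`Garban2011_fourArm_multiscale` (`FourArmGarban.lean`; C. Garban, Appendix B of O. Schramm,
S. Smirnov, *On the scaling limits of planar percolation*, Ann. Probab. 39 (2011), Lemma B.1;
J. van den Berg, P. Nolin, Progr. Probab. 77 (2020), Lemma 8). Bond percolation on `ℤ²`,
`p = 1/2`.

Garban's proof (loc. cit., "Proof of Lemma B.1") runs, for two scales `r ≤ R`, on an `R × R`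
square `Q` cut in its middle third into `(R/3r)²` squares `Q_j` of size `r`, with the crossing
variable `X = 2·1_{Q crossed} - 1`, the circuit bits `C_j` (`FourArmGarbanCircuitBits.lean`)
and the revealment indicators `Y_j = 1_{the interface γ meets Q_j}`, through the displayed chain

* (B.2) `P⁴(r,R) ≍ P[Q_j pivotal for X]` and (B.4) `E[X C_j] ≳ P[Q_j pivotal for X]`
  (Kesten's arm separation), (B.7) `E[X C_j] = E[X C_j Y_j]` — together:
  **`P⁴(r,R) ≲ E[X C_j Y_j]` for every `j`**;
* (B.6) `P[Y_j] ≲ (r/R)^{2ε}` — the two-arm revealment bound, i.e. the HYPOTHESIS of the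
  multi-scale lemma in van den Berg–Nolin's formulation (`π₂(m,n) ≤ c'(m/n)^{2ε}`);
* `E[C_i Y_i C_j Y_j] = 0` for `i ≠ j` (the interface stopped at its first visit to `Q_i ∪ Q_j`)
  and (B.8) Cauchy–Schwarz: `Σ_j E[X C_j Y_j] ≤ √(E[X²]) √(Σ_j E[C_j² Y_j]) ≲ √(Σ_j P[Y_j])`
  (`OrthogonalRevealmentBound.lean`);
* conclusion: `(R/3r)² P⁴(r,R) ≲ √((R/r)² (r/R)^{2ε})`, i.e. `P⁴(r,R) ≲ (r/R)^{1+ε}`.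

This file isolates the percolation-free end of the argument. The hypothesis structure
`GarbanScheme K₁ K₂ K₃ K₄ m n` records, at the pair of scales `(m, n)` of the tree's events
`fourArmTwoClusters m n` / `twoArmOpenDual a b` (`FourArmGarban.lean`), the data `(J, X, C_j,
{Y_j = 1}, a, b)` together with exactly the displayed inputs listed above (fields `sep`, `reveal`,
`orthogonal`, and the trivial bounds `E[X²] ≤ 1`, `|C_j| ≤ 1`, `#J ≥ K₁ (n/m)²`), and
`fourArm_multiscale_of_scheme` / `Garban2011_fourArm_multiscale_of_scheme` PROVE that a scheme
at every pair of scales `n ≥ C₀ m` yields the named fact (for `n < C₀ m` the bound is trivial).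
What remains for `Garban2011_fourArm_multiscale_holds` is therefore precisely the construction
of the scheme: the circuit bits (`FourArmGarbanCircuitBits.lean`, with `E[C_j] = 0` proved), the
interface `γ` with its locality (`orthogonal`, (B.7)) and its two-arm revealment ((B.6) ⇒
`reveal`), and the separation input (B.2)+(B.4) (`sep`), the last being Kesten's arm-separation
theory for bond percolation on `ℤ²`, which the tree does not have (van den Berg–Nolin 2020,
§5.1: "we do not see how to avoid that result in the proof of Lemma 8 for a general `m ≥ 1`").
No definition of a named fact is introduced (the structure is a hypothesis bundle with data).

## References

* O. Schramm, S. Smirnov (appendix by C. Garban), Ann. Probab. 39 (2011), Appendix B, proof of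
  Lemma B.1, (B.2)–(B.8) [SchrammSmirnov2011].
* J. van den Berg, P. Nolin, Progr. Probab. 77 (2020), §4.3 Lemma 8, §5 [VandenbergNolin2020].

Tree: `fourArmTwoClusters`, `twoArmOpenDual`, `Garban2011_fourArm_multiscale`
(`FourArmGarban.lean`), `finsetSum_integral_mul_indicator_le_of_orthogonal`
(`OrthogonalRevealmentBound.lean`). Mathlib: `Real.sqrt`, `Real.rpow` algebra.
-/

noncomputable section

namespace Literature.Probability.Percolation

open _root_.MeasureTheory Set LatticeModels

/-- **Garban's two-layers majority scheme at the scales `(m, n)`** (hypothesis bundle). The data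
are a finite set `J` of labels of mesoscopic squares (their centres), the crossing variable `X`,
the bits `C_j`, the revealment events `V_j = {Y_j = 1}` and the radii `a ≤ b` of the two-arm
event controlling the revealment; the fields are the displayed inputs of the proof of Lemma B.1:
`card_le` — there are `≳ (n/m)²` squares (`j = 1, …, (R/3r)²`); `integral_sq_X_le` — `E[X²] ≤ 1`
(`X = ±1`); `abs_C_le` — `|C_j| ≤ 1`; `orthogonal` — "nondiagonal terms vanish",
`E[C_i Y_i C_j Y_j] = 0` for `i ≠ j`; `sep` — (B.2)+(B.4)+(B.7): `P⁴ ≲ E[X C_j Y_j]` for every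
`j` (the arm-separation input); `reveal` with `ratio_le` — (B.6): `P[Y_j] ≲ π₂` of an annulus of
ratio `≳ n/m` around `Q_j` (translated to the origin). The constants `K₁, …, K₄` are uniform in
the scales. [cite: SchrammSmirnov2011, Appendix B, proof of Lemma B.1, (B.2)-(B.8)] -/
structure GarbanScheme (K₁ K₂ K₃ K₄ : ℝ) (m n : ℕ) where
  /-- Labels (centres) of the mesoscopic squares `Q_j`. -/
  J : Finset (Site 2)
  /-- The crossing variable `X` (any square-integrable function with `E[X²] ≤ 1`). -/
  X : BondConfig (Site 2) → ℝ
  /-- The bits `C_j`. -/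
  C : Site 2 → BondConfig (Site 2) → ℝ
  /-- The revealment events `{Y_j = 1}` ("the interface meets `Q_j`"). -/
  V : Site 2 → Set (BondConfig (Site 2))
  /-- Inner radius of the two-arm event bounding the revealment. -/
  a : ℕ
  /-- Outer radius of the two-arm event bounding the revealment. -/
  b : ℕ
  /-- There are at least `K₁ (n/m)²` squares. -/
  card_le : K₁ * ((n : ℝ) / m) ^ 2 ≤ (J.card : ℝ)
  /-- `X ∈ L²`. -/
  memLp_X : MemLp X 2 (bondPercolation (zdGraph 2) half)
  /-- `E[X²] ≤ 1`. -/
  integral_sq_X_le : ∫ ω, X ω ^ 2 ∂(bondPercolation (zdGraph 2) half) ≤ 1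
  /-- The bits are measurable. -/
  aestronglyMeasurable_C : ∀ j ∈ J, AEStronglyMeasurable (C j) (bondPercolation (zdGraph 2) half)
  /-- `|C_j| ≤ 1`. -/
  abs_C_le : ∀ j ∈ J, ∀ ω, |C j ω| ≤ 1
  /-- The revealment events are measurable. -/
  measurableSet_V : ∀ j ∈ J, MeasurableSet (V j)
  /-- "Nondiagonal terms vanish": `E[C_i Y_i C_j Y_j] = 0` for `i ≠ j`. -/
  orthogonal : ∀ i ∈ J, ∀ j ∈ J, i ≠ j →
    ∫ ω, (V i).indicator (C i) ω * (V j).indicator (C j) ω ∂(bondPercolation (zdGraph 2) half) = 0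
  /-- (B.2)+(B.4)+(B.7): `P⁴(m,n) ≤ K₂ E[X C_j Y_j]` for every square (arm separation). -/
  sep : ∀ j ∈ J, (bondPercolation (zdGraph 2) half).real (fourArmTwoClusters m n) ≤
    K₂ * ∫ ω in V j, X ω * C j ω ∂(bondPercolation (zdGraph 2) half)
  /-- The two-arm annulus is a genuine annulus of `FourArmGarban.lean` (`1 ≤ a`). -/
  one_le_a : 1 ≤ a
  /-- The two-arm annulus is nonempty (`a ≤ b`). -/
  a_le_b : a ≤ b
  /-- The two-arm annulus has ratio `≳ n/m`: `a/b ≤ K₄ m/n`. -/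
  ratio_le : (a : ℝ) / b ≤ K₄ * m / n
  /-- (B.6): the revealment probability is at most `K₃ π₂(a, b)`. -/
  reveal : ∀ j ∈ J, (bondPercolation (zdGraph 2) half).real (V j) ≤
    K₃ * (bondPercolation (zdGraph 2) half).real (twoArmOpenDual a b)

/-- **Garban's assembly** (Schramm–Smirnov 2011, App. B, end of the proof of Lemma B.1: "Summing
over all `Q_j`'s [...] Combining this with (B.2), (B.5), (B.8), we conclude
`P⁴(r,R) ≲ (3r/R)² Σ_j P[Q_j pivotal for X] ≲ (r/R)² (r/R)^{ε-1} = (r/R)^{1+ε}`"). If a scheme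
with constants `K₁ > 0`, `K₂, K₃, K₄ ≥ 0` exists at every pair of scales `n ≥ C₀ m` (`m ≥ 1`),
and `π₂(m,n) ≤ c'(m/n)^{2ε}` for all `1 ≤ m ≤ n`, then for all `1 ≤ m ≤ n`,
`π₄(m,n) ≤ (K₂ √(K₃ c') K₄^ε / √K₁ + C₀^{1+ε}) (m/n)^{1+ε}`.
[cite: SchrammSmirnov2011, Appendix B, proof of Lemma B.1, (B.8) and the final display] -/
theorem fourArm_multiscale_of_scheme {ε : ℝ} (hε : 0 < ε) {K₁ K₂ K₃ K₄ : ℝ} (hK₁ : 0 < K₁)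
    (hK₂ : 0 ≤ K₂) (hK₃ : 0 ≤ K₃) (hK₄ : 0 ≤ K₄) {C₀ : ℕ} (hC₀ : 1 ≤ C₀)
    (hS : ∀ m n : ℕ, 1 ≤ m → C₀ * m ≤ n → Nonempty (GarbanScheme K₁ K₂ K₃ K₄ m n))
    {c' : ℝ} (hc' : 0 < c')
    (h₂ : ∀ m n : ℕ, 1 ≤ m → m ≤ n →
      (bondPercolation (zdGraph 2) half).real (twoArmOpenDual m n) ≤
        c' * ((m : ℝ) / n) ^ (2 * ε))
    {m n : ℕ} (hm : 1 ≤ m) (hmn : m ≤ n) :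
    (bondPercolation (zdGraph 2) half).real (fourArmTwoClusters m n) ≤
      (K₂ * Real.sqrt (K₃ * c') * K₄ ^ ε / Real.sqrt K₁ + (C₀ : ℝ) ^ (1 + ε)) *
        ((m : ℝ) / n) ^ (1 + ε) := by
  set μ := bondPercolation (zdGraph 2) half with hμ
  set q : ℝ := (m : ℝ) / n with hq
  have hm0 : (0 : ℝ) < m := by exact_mod_cast hm
  have hn0 : (0 : ℝ) < n := by exact_mod_cast (hm.trans hmn)
  have hq0 : 0 < q := div_pos hm0 hn0
  have hq1 : q ≤ 1 := (div_le_one hn0).2 (by exact_mod_cast hmn)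
  set c₁ : ℝ := K₂ * Real.sqrt (K₃ * c') * K₄ ^ ε / Real.sqrt K₁ with hc₁
  have hc₁0 : 0 ≤ c₁ := by positivity
  have hC₀0 : (0 : ℝ) < C₀ := by exact_mod_cast hC₀
  have hqpow0 : 0 ≤ q ^ (1 + ε) := by positivity
  by_cases hfar : C₀ * m ≤ n
  · -- the scheme at scales `(m, n)`
    obtain ⟨S⟩ := hS m n hm hfar
    set N : ℝ := (S.J.card : ℝ) with hN
    set P4 : ℝ := μ.real (fourArmTwoClusters m n) with hP4
    have hnm : 1 ≤ (n : ℝ) / m := by rw [le_div_iff₀ hm0, one_mul]; exact_mod_cast hmn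
    have hNK : K₁ * ((n : ℝ) / m) ^ 2 ≤ N := S.card_le
    have hNpos : 0 < N := lt_of_lt_of_le (by positivity) hNK
    -- (1) summing `sep` over the squares
    have h1 : N * P4 ≤ K₂ * ∑ j ∈ S.J, ∫ ω in S.V j, S.X ω * S.C j ω ∂μ := by
      have := Finset.sum_le_sum S.sep
      rwa [Finset.sum_const, nsmul_eq_mul, ← Finset.mul_sum] at this
    -- (2) Cauchy–Schwarz with vanishing nondiagonal terms (B.8)
    have h2 : ∑ j ∈ S.J, ∫ ω in S.V j, S.X ω * S.C j ω ∂μ ≤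
        Real.sqrt (∑ j ∈ S.J, μ.real (S.V j)) := by
      have h := finsetSum_integral_mul_indicator_le_of_orthogonal S.J zero_le_one S.memLp_X
        S.aestronglyMeasurable_C S.abs_C_le S.measurableSet_V S.orthogonal
      have hX : Real.sqrt (∫ ω, S.X ω ^ 2 ∂μ) ≤ 1 := by
        rw [← Real.sqrt_one]; exact Real.sqrt_le_sqrt S.integral_sq_X_le
      rw [one_mul] at h
      exact h.trans (mul_le_of_le_one_left (Real.sqrt_nonneg _) hX)
    -- (3) revealment (B.6) and the two-arm hypothesis
    set M : ℝ := K₃ * c' * (K₄ * q) ^ (2 * ε) with hM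
    have hM0 : 0 ≤ M := by positivity
    have h3 : ∑ j ∈ S.J, μ.real (S.V j) ≤ N * M := by
      have hab0 : (0 : ℝ) ≤ S.a / S.b := by positivity
      have hratio : (S.a : ℝ) / S.b ≤ K₄ * q := by
        have := S.ratio_le; rwa [mul_div_assoc] at this
      have htwo : μ.real (twoArmOpenDual S.a S.b) ≤ c' * (K₄ * q) ^ (2 * ε) :=
        (h₂ S.a S.b S.one_le_a S.a_le_b).trans
          (mul_le_mul_of_nonneg_left (Real.rpow_le_rpow hab0 hratio (by positivity)) hc'.le)
      have hj : ∀ j ∈ S.J, μ.real (S.V j) ≤ M := fun j hj =>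
        (S.reveal j hj).trans ((mul_le_mul_of_nonneg_left htwo hK₃).trans_eq (by
          rw [hM]; ring))
      have := Finset.sum_le_sum hj
      rwa [Finset.sum_const, nsmul_eq_mul] at this
    -- (4) `N · P4 ≤ K₂ √(N M)`, hence `√N · P4 ≤ K₂ √M`
    have h4 : N * P4 ≤ K₂ * Real.sqrt (N * M) :=
      h1.trans (mul_le_mul_of_nonneg_left (h2.trans (Real.sqrt_le_sqrt h3)) hK₂)
    have hsN : 0 < Real.sqrt N := Real.sqrt_pos.2 hNpos
    have h5 : Real.sqrt N * P4 ≤ K₂ * Real.sqrt M := by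
      have h4' : Real.sqrt N * (Real.sqrt N * P4) ≤ Real.sqrt N * (K₂ * Real.sqrt M) := by
        calc Real.sqrt N * (Real.sqrt N * P4) = N * P4 := by
              rw [← mul_assoc, Real.mul_self_sqrt hNpos.le]
          _ ≤ K₂ * Real.sqrt (N * M) := h4
          _ = Real.sqrt N * (K₂ * Real.sqrt M) := by rw [Real.sqrt_mul hNpos.le]; ring
      exact le_of_mul_le_mul_left h4' hsN
    -- (5) `√N ≥ √K₁ · n/m`
    have h6 : Real.sqrt K₁ * ((n : ℝ) / m) ≤ Real.sqrt N := by
      have := Real.sqrt_le_sqrt hNK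
      rwa [Real.sqrt_mul hK₁.le, Real.sqrt_sq (by positivity)] at this
    have h7 : Real.sqrt K₁ * ((n : ℝ) / m) * P4 ≤ K₂ * Real.sqrt M :=
      (mul_le_mul_of_nonneg_right h6 measureReal_nonneg).trans h5
    -- (6) `√M = √(K₃ c') (K₄ q)^ε`
    have hsqM : Real.sqrt M = Real.sqrt (K₃ * c') * (K₄ ^ ε * q ^ ε) := by
      rw [hM, Real.sqrt_mul (by positivity), Real.sqrt_eq_rpow ((K₄ * q) ^ (2 * ε)),
        ← Real.rpow_mul (by positivity), ← Real.mul_rpow hK₄ hq0.le]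
      congr 1
      ring_nf
    -- (7) solve for `P4`
    have hpos : 0 < Real.sqrt K₁ * ((n : ℝ) / m) := by positivity
    have h8 : P4 ≤ K₂ * Real.sqrt M / (Real.sqrt K₁ * ((n : ℝ) / m)) := by
      rw [le_div_iff₀ hpos]
      calc P4 * (Real.sqrt K₁ * ((n : ℝ) / m)) = Real.sqrt K₁ * ((n : ℝ) / m) * P4 := by ring
        _ ≤ K₂ * Real.sqrt M := h7
    have h9 : K₂ * Real.sqrt M / (Real.sqrt K₁ * ((n : ℝ) / m)) = c₁ * q ^ (1 + ε) := by
      rw [hsqM, hc₁, Real.rpow_add hq0, Real.rpow_one, hq]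
      have hK₁' : Real.sqrt K₁ ≠ 0 := (Real.sqrt_pos.2 hK₁).ne'
      field_simp
    have h10 : P4 ≤ c₁ * q ^ (1 + ε) := h8.trans_eq h9
    calc P4 ≤ c₁ * q ^ (1 + ε) := h10
      _ ≤ (c₁ + (C₀ : ℝ) ^ (1 + ε)) * q ^ (1 + ε) := by
          gcongr
          exact le_add_of_nonneg_right (by positivity)
  · -- bounded ratio `n < C₀ m`: the bound is trivial
    have hlt : n < C₀ * m := not_le.1 hfar
    have hCq : 1 ≤ (C₀ : ℝ) * q := by
      rw [hq, mul_div_assoc', le_div_iff₀ hn0, one_mul]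
      exact_mod_cast hlt.le
    have hpow : 1 ≤ ((C₀ : ℝ) * q) ^ (1 + ε) := Real.one_le_rpow hCq (by positivity)
    rw [Real.mul_rpow hC₀0.le hq0.le] at hpow
    calc μ.real (fourArmTwoClusters m n) ≤ 1 := measureReal_le_one
      _ ≤ (C₀ : ℝ) ^ (1 + ε) * q ^ (1 + ε) := hpow
      _ ≤ (c₁ + (C₀ : ℝ) ^ (1 + ε)) * q ^ (1 + ε) := by
          gcongr
          exact le_add_of_nonneg_left hc₁0

/-- **The named fact from a scheme at every pair of scales.** If Garban's scheme (with constants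
uniform in the scales) exists whenever `n ≥ C₀ m`, `m ≥ 1`, then `Garban2011_fourArm_multiscale`
holds: for every `ε > 0` for which `π₂(m,n) ≤ c'(m/n)^{2ε}`, there is `c > 0` with
`π₄(m,n) ≤ c (m/n)^{1+ε}` for all `1 ≤ m ≤ n`. This reduces the fact to the construction of
the scheme (circuit bits, interface locality and revealment, and the arm-separation input
(B.2)+(B.4)). [cite: SchrammSmirnov2011, Appendix B, Lemma B.1 (structure of the proof)] -/
theorem Garban2011_fourArm_multiscale_of_scheme {K₁ K₂ K₃ K₄ : ℝ} (hK₁ : 0 < K₁)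
    (hK₂ : 0 ≤ K₂) (hK₃ : 0 ≤ K₃) (hK₄ : 0 ≤ K₄) {C₀ : ℕ} (hC₀ : 1 ≤ C₀)
    (hS : ∀ m n : ℕ, 1 ≤ m → C₀ * m ≤ n → Nonempty (GarbanScheme K₁ K₂ K₃ K₄ m n)) :
    Garban2011_fourArm_multiscale := by
  rintro ε hε ⟨c', hc', h₂⟩
  have hC₀0 : (0 : ℝ) < C₀ := by exact_mod_cast hC₀
  refine ⟨K₂ * Real.sqrt (K₃ * c') * K₄ ^ ε / Real.sqrt K₁ + (C₀ : ℝ) ^ (1 + ε),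
    add_pos_of_nonneg_of_pos (by positivity) (Real.rpow_pos_of_pos hC₀0 _), ?_⟩
  intro m n hm hmn
  exact fourArm_multiscale_of_scheme hε hK₁ hK₂ hK₃ hK₄ hC₀ hS hc' h₂ hm hmn

end Literature.Probability.Percolation
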